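import Summits.CriticalPhenomena.PercolationContinuityZ3.Theorems.SahiMasterFamilyRigidityAllDetector
import Summits.CriticalPhenomena.PercolationContinuityZ3.Theorems.SahiMasterFamilySandwich

/-!
# (ALL-R3), preliminaries: events determined by a coordinate class, and the two consequences of an active pair

Unit `prim-masterthm-p4` (gen 9), crux anchor stmt-CriticalPhenomena-4575.  Seat document HOME/prim-masterthm-p4/PROOF-CAP-NOTES.md §7 (Theorem 2).
This file: `mem_iff_of_forall_insert_iff` (an event unchanged by toggling coordinates outside `F` is decided on `F`), the membership form of pivotal sets,
and, for one ACTIVE PAIR of the trivial form (a pivotal set `Piv_e L` that is non-empty and determined by a coordinate class `Tf ∋ e`), the lemmas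
(KEY) `inter_type_nonempty_of_active`, (M) `exists_subset_type_of_active`, (UNI) `not_affects_of_unique_active` used by
`SahiMasterFamilyAllR3.lean`.  The theorem they serve:

THEOREM (gen 8's conjecture (ALL-R3), now proved, every size of the ground set).  Let `U_0,…,U_3` be non-constant increasing events on `{0,1}^ι`
such that EVERY coordinate is essential for exactly three of them ("all-r3": for each `e` exactly one member `U_{τ(e)}` ignores `e`), and no sub-triple lies in
`Z_3`.  Then `E_4(μ_p; 1_U) ≠ 0` for some interior `p` (`exists_interior_sahiE_four_ne_zero_of_allR3`).

PROOF.  Suppose `E_4 ≡ 0`.  By THEOREM R* (gen 8, `RigidityAll.trivial_form_at`) every coordinate `e`, with free member `f = τ(e)`, is in TRIVIAL FORM: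
exactly one other member `l = j₀(e)` ("active at `e`") has its pivotal set `Piv_e U_l` meeting `U_f`, and that pivotal set ignores every coordinate that
`U_f` uses — i.e. it is determined by the type class `T^f := {y | U_f ignores y}` (minus `e`).  Two consequences for an active pair `(l, f)`:
(KEY) every configuration of `U_l` meets `T^f` (`inter_type_nonempty_of_active`), and (M) `U_l` has a configuration inside `T^f` (`exists_subset_type_of_active`);
so a member is active for at most one type.  If a type had a unique active member `l`, then `U_l` would ignore everything outside that type
(`not_affects_of_unique_active`) — impossible, since with ≥ 3 non-empty types `U_l` uses another type; so every non-empty type has two active members, and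
counting active pairs gives `6 ≤ 4`.  With exactly two non-empty types the two "small" members are independent and the family has a `Z_3` sub-triple
(slot = a full-support member), excluded.  No positivity is involved; axioms standard. [this work]
-/

noncomputable section

open scoped Classical

namespace Summit.CriticalPhenomena.PercolationContinuityZ3.Theorems

namespace AllR3

open Finset Function
open Literature.Combinatorics.Sahi2008
open Literature.Probability.LatticeModels.Kahn2022 (Affects)
open Literature.Probability.Percolation (DeterminedBy determinedBy_iff)
open Literature.Probability.Percolation.DecisionTree (ind ind_of_mem ind_of_not_mem)
open SharedCoordinate RigidityAll

variable {ι : Type} [Fintype ι]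

/-! ### Events determined by a set of coordinates -/

/-- If an event is unchanged by toggling every coordinate outside `F`, then two configurations agreeing on `F` are both in or both out
(finite induction on the set of disagreements). [folklore] -/
theorem mem_iff_of_forall_insert_iff (P : Set (Set ι)) (F : Set ι) (hP : ∀ y, y ∉ F → ∀ ω, insert y ω ∈ P ↔ ω ∈ P)
    {ω ω' : Set ι} (h : ∀ y ∈ F, y ∈ ω ↔ y ∈ ω') : ω ∈ P ↔ ω' ∈ P := by
  -- induction on a finset `s` outside which `ω` and `ω'` agree
  suffices key : ∀ (s : Finset ι) (ω ω' : Set ι), (∀ y, y ∉ s → (y ∈ ω ↔ y ∈ ω')) → (∀ y ∈ s, y ∉ F) → (ω ∈ P ↔ ω' ∈ P) by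
    refine key (univ.filter fun y => y ∉ F) ω ω' (fun y hy => ?_) (fun y hy => (mem_filter.1 hy).2)
    have : y ∈ F := by simpa using hy
    exact h y this
  intro s
  induction s using Finset.induction_on with
  | empty =>
    intro ω ω' hagree _
    have : ω = ω' := Set.ext fun y => hagree y (by simp)
    rw [this]
  | @insert a s ha ih =>
    intro ω ω' hagree hsF
    have haF : a ∉ F := hsF a (mem_insert_self a s)
    -- move `ω` to agree with `ω'` at `a`
    let ω₁ : Set ι := if a ∈ ω' then insert a ω else ω \ {a}
    have step : ω ∈ P ↔ ω₁ ∈ P := by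
      by_cases ha' : a ∈ ω'
      · simp only [ω₁, ha', if_true]
        exact (hP a haF ω).symm
      · simp only [ω₁, ha', if_false]
        by_cases haω : a ∈ ω
        · have e1 : insert a (ω \ {a}) = ω := by
            ext y; by_cases hy : y = a <;> simp [hy, haω]
          rw [← hP a haF (ω \ {a}), e1]
        · rw [Set.sdiff_singleton_eq_self haω]
    rw [step]
    refine ih ω₁ ω' (fun y hy => ?_) (fun y hy => hsF y (mem_insert_of_mem hy))
    by_cases hya : y = a
    · subst hya
      by_cases ha' : y ∈ ω' <;> simp [ω₁, ha']
    · have hy' : y ∉ insert a s := by simp [hya, hy]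
      have := hagree y hy'
      by_cases ha' : a ∈ ω'
      · simp only [ω₁, ha', if_true, Set.mem_insert_iff, hya, false_or]; exact this
      · simp only [ω₁, ha', if_false, Set.mem_sdiff, Set.mem_singleton_iff, hya, not_false_eq_true, and_true]; exact this

omit [Fintype ι] in
/-- Membership in a pivotal set: `ω ∈ Piv_e A ↔ ω ∪ {e} ∈ A ∧ ω ∖ {e} ∉ A`. [this work] -/
theorem mem_pivSet_iff {e : ι} {A : Set (Set ι)} {ω : Set ι} :
    ω ∈ pivSet e A ↔ insert e ω ∈ A ∧ ω \ {e} ∉ A := by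
  simp only [pivSet, Set.mem_sdiff, mem_secAt, forceAt, cond_true, cond_false]


/-! ### One active pair `(L, F)` at a coordinate `e`: consequences of the trivial form

`Tf` is the set of coordinates the free member `F` ignores (its "type class"); the trivial form at `e ∈ Tf` with active member `L` says that the
pivotal set `Piv_e L` is non-empty and ignores every coordinate outside `Tf`. -/

section Active

variable {L : Set (Set ι)} {Tf : Set ι} {e : ι}

/-- **(KEY)** If `Piv_e L` is non-empty and determined by `Tf ∋ e`, then every configuration of the increasing event `L` meets `Tf`. [this work] -/
theorem inter_type_nonempty_of_active (hL : IsUpperSet L) (he : e ∈ Tf)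
    (hdet : ∀ y, y ∉ Tf → ∀ ω, insert y ω ∈ pivSet e L ↔ ω ∈ pivSet e L) (hne : (pivSet e L).Nonempty)
    {θ : Set ι} (hθ : θ ∈ L) : ∃ z ∈ Tf, z ∈ θ := by
  obtain ⟨ω₀, hω₀⟩ := hne
  -- open everything outside `Tf`
  set ω₁ : Set ι := {y | (y ∈ Tf ∧ y ∈ ω₀) ∨ y ∉ Tf} with hω₁
  have h1 : ω₁ ∈ pivSet e L :=
    (mem_iff_of_forall_insert_iff (pivSet e L) Tf hdet (ω := ω₀) (ω' := ω₁)
      (fun y hy => by simp [hω₁, hy])).1 hω₀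
  have hout : ω₁ \ {e} ∉ L := (mem_pivSet_iff.1 h1).2
  by_contra hcon
  push Not at hcon
  apply hout
  refine hL (fun z hz => ?_) hθ
  have hzT : z ∉ Tf := fun hzT => hcon z hzT hz
  have hze : z ≠ e := fun h => hzT (h ▸ he)
  simp [hω₁, hzT, hze]

/-- **(M)** Under the same hypotheses `L` has a configuration inside `Tf`. [this work] -/
theorem exists_subset_type_of_active (he : e ∈ Tf)
    (hdet : ∀ y, y ∉ Tf → ∀ ω, insert y ω ∈ pivSet e L ↔ ω ∈ pivSet e L) (hne : (pivSet e L).Nonempty) :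
    ∃ θ ∈ L, θ ⊆ Tf := by
  obtain ⟨ω₀, hω₀⟩ := hne
  set ω₂ : Set ι := ω₀ ∩ Tf with hω₂
  have h2 : ω₂ ∈ pivSet e L :=
    (mem_iff_of_forall_insert_iff (pivSet e L) Tf hdet (ω := ω₀) (ω' := ω₂)
      (fun y hy => by simp [hω₂, hy])).1 hω₀
  refine ⟨insert e ω₂, (mem_pivSet_iff.1 h2).1, ?_⟩
  exact Set.insert_subset he Set.inter_subset_right

/-- **(UNI)** If EVERY pivotal set `Piv_e L`, `e ∈ Tf`, is determined by `Tf`, and every configuration of `L` meets `Tf`, then `L` ignores every coordinate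
outside `Tf`. [this work] -/
theorem not_affects_of_unique_active (hL : IsUpperSet L)
    (hdet : ∀ e ∈ Tf, ∀ y, y ∉ Tf → ∀ ω, insert y ω ∈ pivSet e L ↔ ω ∈ pivSet e L)
    (hkey : ∀ θ ∈ L, ∃ z ∈ Tf, z ∈ θ) {y : ι} (hy : y ∉ Tf) : ¬ Affects L y := by
  rintro ⟨ω, hω, hins⟩
  -- peel coordinates of `Tf` off `insert y ω` while staying in `L`
  suffices main : ∀ (n : ℕ) (θ : Set ι), (θ ∩ Tf).ncard = n → θ ∈ L → θ ⊆ insert y ω → ω ∈ L from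
    hω (main _ (insert y ω) rfl hins subset_rfl)
  intro n
  induction n using Nat.strong_induction_on with
  | _ n ih =>
    intro θ hcard hθ hsub
    obtain ⟨e, heT, heθ⟩ := hkey θ hθ
    by_cases hdel : θ \ {e} ∈ L
    · -- remove `e` and recurse
      have hlt : ((θ \ {e}) ∩ Tf).ncard < n := by
        rw [← hcard]
        apply Set.ncard_lt_ncard _ (Set.toFinite _)
        refine ⟨fun z hz => ⟨hz.1.1, hz.2⟩, fun hss => ?_⟩
        have : e ∈ (θ \ {e}) ∩ Tf := hss ⟨heθ, heT⟩
        exact this.1.2 rfl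
      exact ih _ hlt (θ \ {e}) rfl hdel (Set.sdiff_subset.trans hsub)
    · -- `e` is pivotal for `L` at `θ ∖ {e}`; determinedness moves the configuration inside `Tf`
      have hpiv : θ \ {e} ∈ pivSet e L := by
        rw [mem_pivSet_iff]
        refine ⟨?_, by simpa using hdel⟩
        rwa [Set.insert_sdiff_singleton, Set.insert_eq_of_mem heθ]
      set θ'' : Set ι := (θ \ {e}) ∩ Tf with hθ''
      have h'' : θ'' ∈ pivSet e L :=
        (mem_iff_of_forall_insert_iff (pivSet e L) Tf (hdet e heT) (ω := θ \ {e}) (ω' := θ'')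
          (fun z hz => by simp [hθ'', hz])).1 hpiv
      have hin : insert e θ'' ∈ L := (mem_pivSet_iff.1 h'').1
      refine hL (fun z hz => ?_) hin
      -- `insert e θ'' ⊆ θ ∩ Tf ⊆ ω` because `y ∉ Tf`
      have hzθ : z ∈ θ ∧ z ∈ Tf := by
        rcases hz with rfl | hz
        · exact ⟨heθ, heT⟩
        · simp only [hθ'', Set.mem_inter_iff, Set.mem_sdiff] at hz
          exact ⟨hz.1.1, hz.2⟩
      have hzω' : z ∈ insert y ω := hsub hzθ.1
      rcases hzω' with rfl | h
      · exact absurd hzθ.2 hy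
      · exact h

end Active


/-! ### Pivotal sets inherit ignored coordinates -/

omit [Fintype ι] in
/-- If `A` ignores `y ≠ e` then so does `Piv_e A`. [this work] -/
theorem insert_mem_pivSet_iff {A : Set (Set ι)} {e y : ι} (hye : y ≠ e) (hA : ∀ ω, insert y ω ∈ A ↔ ω ∈ A) (ω : Set ι) :
    insert y ω ∈ pivSet e A ↔ ω ∈ pivSet e A := by
  rw [mem_pivSet_iff, mem_pivSet_iff, Set.insert_comm, hA, ← Set.insert_sdiff_singleton_comm hye, hA]

omit [Fintype ι] in
/-- A coordinate affecting an increasing event has a non-empty pivotal set. [this work] -/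
theorem pivSet_nonempty_of_affects {A : Set (Set ι)} (hA : IsUpperSet A) {e : ι} (h : Affects A e) : (pivSet e A).Nonempty := by
  obtain ⟨ω, hω, hins⟩ := h
  refine ⟨ω \ {e}, mem_pivSet_of_pivotal (fun h => h.2 rfl) (fun h => hω (hA Set.sdiff_subset h)) ?_⟩
  rwa [Set.insert_sdiff_singleton]

omit [Fintype ι] in
/-- An event that ignores `e` is not affected by `e`. [folklore] -/
theorem not_affects_of_forall_insert_iff {A : Set (Set ι)} {e : ι} (h : ∀ ω, insert e ω ∈ A ↔ ω ∈ A) : ¬ Affects A e :=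
  fun ⟨ω, hω, hins⟩ => hω ((h ω).1 hins)

end AllR3

end Summit.CriticalPhenomena.PercolationContinuityZ3.Theorems
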